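import Mathlib
import HarnessLib
import Summits.ValiantsHypothesis.ValiantsHypothesis.Theorems.MonotoneRestorationOrbitRestorationQPNarrowSpanAlgebra

/-!
# Row characters are `1` or `sign`, and column-only cocycle trivialisation

Route MonotoneRestoration, crux `OrbitRestorationQP` (stmt-ValiantsHypothesis-18293), SPAN-currency lane of the open
sub-rung A_∞ (`stub_sigmaPiSigmaValue`), `ΠΣ` part; glue for the PAIRING THEOREM
(`SuperAtoms.prod_mem_narrowSpan_of_signStable_rowAtomFactors`, `Theorems/…SignStableProducts.lean`).  Helper
(`--supports`), def-free.

The pairing theorem wants a family of column-label groupings `G_T` that is EXACTLY permuted by the column renamings and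
multiplied by ONE `±1`-valued function `ε(σ)` by the row renamings.  Unique factorisation only gives transport up to
units, and a priori each grouping has its own multiplicative row multiplier.  This file supplies the two normalisations:

* `perm_character_eq_one_or_sign` — a multiplicative function `v : Sym_n → ℂ` with `v 1 = 1` is identically `1` or
  equal to the sign character (transpositions are involutions and pairwise conjugate; `Equiv.Perm.swap_induction_on`);
  `perm_character_sq` — hence `v(σ)² = 1`;
* `rename_col_mul`, `rename_col_one`, `rename_col_inv`, `col_translate_scalar_unique`,
  **`exists_rescaling_of_colEigenFree_transport`** — COLUMN-ONLY COCYCLE TRIVIALISATION: if every column renaming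
  carries each `L_i ≠ 0` to a unit multiple of `L_{κ τ i}` and no column renaming rescales an `L_i` non-trivially
  (column-untwisted), then after rescaling by nonzero constants the column renamings carry `d_i L_i` to
  `d_{κ τ i} L_{κ τ i}` EXACTLY (the row action is not involved, so row sign characters are allowed) — the column-only
  twin of `NormalisedFactors.exists_rescaling_of_eigenFree_transport`; permutation form
  `exists_rescaling_exactly_colPermuted`.

No registered stub is closed; the crux and VP ≠ VNP are not moved. [folklore]
-/

noncomputable section

-- `Summit.ValiantsHypothesis.ValiantsHypothesis.…` is the tree's single-conjunct layout (Sub = Summit).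
set_option linter.dupNamespace false

namespace Summit.ValiantsHypothesis.ValiantsHypothesis.Theorems

namespace SuperAtoms

open MvPolynomial Finset Equiv

variable {n : ℕ}

/-! ### Multiplicative functions on the symmetric group -/

/-- **A multiplicative `ℂ`-valued function on `Sym_n` with `v 1 = 1` is `1` or `sign`.** [folklore] -/
theorem perm_character_eq_one_or_sign (v : Perm (Fin n) → ℂ) (hmul : ∀ σ τ, v (σ * τ) = v σ * v τ) (h1 : v 1 = 1) :
    (∀ σ, v σ = 1) ∨ (∀ σ, v σ = ((Equiv.Perm.sign σ : ℤˣ) : ℤ)) := by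
  classical
  have hinv : ∀ σ, v σ * v σ⁻¹ = 1 := fun σ => by rw [← hmul, mul_inv_cancel, h1]
  have hconj : ∀ σ g, v (g * σ * g⁻¹) = v σ := by
    intro σ g
    rw [hmul, hmul, mul_comm (v g) (v σ), mul_assoc, hinv, mul_one]
  have hsw : ∀ a b : Fin n, a ≠ b → v (swap a b) = 1 ∨ v (swap a b) = -1 := by
    intro a b _
    have h : v (swap a b) * v (swap a b) = 1 := by rw [← hmul, swap_mul_self, h1]
    exact mul_self_eq_one_iff.1 h
  have hconst : ∀ a b c d : Fin n, a ≠ b → c ≠ d → v (swap a b) = v (swap c d) := by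
    intro a b c d hab hcd
    obtain ⟨g, hg⟩ := isConj_iff.1 (Equiv.Perm.isConj_swap hab hcd)
    rw [← hg, hconj]
  by_cases hn : ∃ a b : Fin n, a ≠ b
  · obtain ⟨a₀, b₀, h₀⟩ := hn
    rcases hsw a₀ b₀ h₀ with hs | hs
    · left
      intro σ
      induction σ using Equiv.Perm.swap_induction_on with
      | one => exact h1
      | swap_mul f x y hxy ih => rw [hmul, ih, hconst x y a₀ b₀ hxy h₀, hs, one_mul]
    · right
      intro σ
      induction σ using Equiv.Perm.swap_induction_on with
      | one => rw [h1, Equiv.Perm.sign_one]; simp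
      | swap_mul f x y hxy ih =>
        rw [hmul, ih, hconst x y a₀ b₀ hxy h₀, hs, Equiv.Perm.sign_mul, Equiv.Perm.sign_swap hxy]
        simp
  · left
    simp only [ne_eq, not_exists, not_not] at hn
    intro σ
    have : σ = 1 := Equiv.ext fun x => hn _ _
    rw [this, h1]

/-- **Hence `v(σ)² = 1`.** [folklore] -/
theorem perm_character_sq (v : Perm (Fin n) → ℂ) (hmul : ∀ σ τ, v (σ * τ) = v σ * v τ) (h1 : v 1 = 1)
    (σ : Perm (Fin n)) : v σ * v σ = 1 := by
  rcases perm_character_eq_one_or_sign v hmul h1 with h | h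
  · rw [h, one_mul]
  · rw [h, ← Int.cast_mul, ← Units.val_mul, Int.units_mul_self, Units.val_one, Int.cast_one]

/-! ### Column renamings -/

/-- Composition of column renamings. [folklore] -/
theorem rename_col_mul (τ τ' : Perm (Fin n)) (p : MvPolynomial (Fin n × Fin n) ℂ) :
    rename (fun P : Fin n × Fin n => (P.1, τ P.2)) (rename (fun P : Fin n × Fin n => (P.1, τ' P.2)) p) =
      rename (fun P : Fin n × Fin n => (P.1, (τ * τ') P.2)) p := by
  rw [rename_rename]
  rfl

/-- The trivial column renaming is the identity. [folklore] -/
theorem rename_col_one (p : MvPolynomial (Fin n × Fin n) ℂ) :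
    rename (fun P : Fin n × Fin n => (P.1, (1 : Perm (Fin n)) P.2)) p = p := by
  have h : (fun P : Fin n × Fin n => (P.1, (1 : Perm (Fin n)) P.2)) = id := by
    funext P
    rfl
  rw [h, rename_id]
  rfl

/-- A column renaming is undone by the inverse renaming. [folklore] -/
theorem rename_col_inv (τ : Perm (Fin n)) (p : MvPolynomial (Fin n × Fin n) ℂ) :
    rename (fun P : Fin n × Fin n => (P.1, τ⁻¹ P.2)) (rename (fun P : Fin n × Fin n => (P.1, τ P.2)) p) = p := by
  rw [rename_col_mul, inv_mul_cancel, rename_col_one]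

/-- **In a column-eigen-free family, two column translates of one member on the line of another coincide.** [folklore] -/
theorem col_translate_scalar_unique {ι : Type} (L : ι → MvPolynomial (Fin n × Fin n) ℂ) (hL0 : ∀ i, L i ≠ 0)
    (heigen : ∀ (τ : Perm (Fin n)) (i : ι) (c : ℂ),
      rename (fun P : Fin n × Fin n => (P.1, τ P.2)) (L i) = C c * L i → c = 1)
    {τ τ' : Perm (Fin n)} {j i : ι} {c c' : ℂ}
    (h : rename (fun P : Fin n × Fin n => (P.1, τ P.2)) (L j) = C c * L i)
    (h' : rename (fun P : Fin n × Fin n => (P.1, τ' P.2)) (L j) = C c' * L i) : c = c' := by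
  have hj : L j = C c * rename (fun P : Fin n × Fin n => (P.1, τ⁻¹ P.2)) (L i) := by
    have h2 := congrArg (rename (fun P : Fin n × Fin n => (P.1, τ⁻¹ P.2))) h
    rwa [rename_col_inv, map_mul, rename_C] at h2
  have hc : c ≠ 0 := by
    rintro rfl
    rw [C_0, zero_mul] at hj
    exact hL0 j hj
  have h2 : C c * rename (fun P : Fin n × Fin n => (P.1, (τ' * τ⁻¹) P.2)) (L i) = C c' * L i := by
    rw [← rename_col_mul, ← rename_C (fun P : Fin n × Fin n => (P.1, τ' P.2)) c, ← map_mul, ← hj]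
    exact h'
  have h3 : rename (fun P : Fin n × Fin n => (P.1, (τ' * τ⁻¹) P.2)) (L i) = C (c⁻¹ * c') * L i := by
    have h4 := congrArg (fun q => C c⁻¹ * q) h2
    rwa [← mul_assoc, ← mul_assoc, ← map_mul, ← map_mul, inv_mul_cancel₀ hc, C_1, one_mul] at h4
  have h5 := heigen _ i _ h3
  calc c = c * (c⁻¹ * c') := by rw [h5, mul_one]
    _ = c' := by rw [← mul_assoc, mul_inv_cancel₀ hc, one_mul]

/-- **COLUMN-ONLY COCYCLE TRIVIALISATION.**  If every column renaming carries each `L_i ≠ 0` to a unit multiple of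
`L_{κ τ i}` and the family is column-eigen-free (no column renaming rescales a member non-trivially), then after
rescaling by nonzero constants the column renamings carry `d_i L_i` to `d_{κ τ i} L_{κ τ i}` exactly.  The row action
plays no role. [folklore] -/
theorem exists_rescaling_of_colEigenFree_transport {ι : Type} (L : ι → MvPolynomial (Fin n × Fin n) ℂ)
    (hL0 : ∀ i, L i ≠ 0) (κ : Perm (Fin n) → ι → ι)
    (hassoc : ∀ (τ : Perm (Fin n)) (i : ι), ∃ c : ℂ, c ≠ 0 ∧
      rename (fun P : Fin n × Fin n => (P.1, τ P.2)) (L i) = C c * L (κ τ i))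
    (heigen : ∀ (τ : Perm (Fin n)) (i : ι) (c : ℂ),
      rename (fun P : Fin n × Fin n => (P.1, τ P.2)) (L i) = C c * L i → c = 1) :
    ∃ d : ι → ℂ, (∀ i, d i ≠ 0) ∧ ∀ (τ : Perm (Fin n)) (i : ι),
      rename (fun P : Fin n × Fin n => (P.1, τ P.2)) (C (d i) * L i) = C (d (κ τ i)) * L (κ τ i) := by
  classical
  -- the line-orbit relation `Q i j`: some column translate of `L j` lies on the line of `L i`
  set Q : ι → ι → Prop := fun i j => ∃ (τ : Perm (Fin n)) (c : ℂ), c ≠ 0 ∧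
    rename (fun P : Fin n × Fin n => (P.1, τ P.2)) (L j) = C c * L i with hQ
  have hQrefl : ∀ i, Q i i := fun i => ⟨1, 1, one_ne_zero, by rw [rename_col_one, C_1, one_mul]⟩
  have hQtrans : ∀ (i i' : ι) (τ : Perm (Fin n)) (c : ℂ), c ≠ 0 →
      rename (fun P : Fin n × Fin n => (P.1, τ P.2)) (L i) = C c * L i' → Q i = Q i' := by
    intro i i' τ c hc h
    funext j
    apply propext
    constructor
    · rintro ⟨τ₁, c₁, hc₁, h₁⟩
      refine ⟨τ * τ₁, c₁ * c, mul_ne_zero hc₁ hc, ?_⟩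
      rw [← rename_col_mul, h₁, map_mul, rename_C, h, ← mul_assoc, ← map_mul]
    · rintro ⟨τ₁, c₁, hc₁, h₁⟩
      refine ⟨τ⁻¹ * τ₁, c₁ * c⁻¹, mul_ne_zero hc₁ (inv_ne_zero hc), ?_⟩
      have hi : rename (fun P : Fin n × Fin n => (P.1, τ⁻¹ P.2)) (L i') = C c⁻¹ * L i := by
        have h2 := congrArg (rename (fun P : Fin n × Fin n => (P.1, τ⁻¹ P.2))) h
        rw [rename_col_inv, map_mul, rename_C] at h2
        have h3 := congrArg (fun q => C c⁻¹ * q) h2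
        rw [← mul_assoc, ← map_mul, inv_mul_cancel₀ hc, C_1, one_mul] at h3
        exact h3.symm
      rw [← rename_col_mul, h₁, map_mul, rename_C, hi, ← mul_assoc, ← map_mul]
  -- canonical member of a line-orbit
  have hne : ∀ i, ∃ j, Q i j := fun i => ⟨i, hQrefl i⟩
  have hchoose : ∀ (P P' : ι → Prop) (hP : ∃ j, P j) (hP' : ∃ j, P' j), P = P' →
      Classical.choose hP = Classical.choose hP' := by
    rintro P P' hP hP' rfl
    rfl
  set jstar : ι → ι := fun i => Classical.choose (hne i) with hjstar
  have hjQ : ∀ i, Q i (jstar i) := fun i => Classical.choose_spec (hne i)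
  have hjeq : ∀ i i', Q i = Q i' → jstar i = jstar i' := fun i i' h => hchoose (Q i) (Q i') (hne i) (hne i') h
  have hdata : ∀ i, ∃ c : ℂ, c ≠ 0 ∧ ∃ τ : Perm (Fin n),
      rename (fun P : Fin n × Fin n => (P.1, τ P.2)) (L (jstar i)) = C c * L i := by
    intro i
    obtain ⟨τ, c, hc, h⟩ := hjQ i
    exact ⟨c, hc, τ, h⟩
  choose d hd0 hdst using hdata
  refine ⟨d, hd0, fun τ i => ?_⟩
  obtain ⟨c₁, hc₁, h1⟩ := hassoc τ i
  have hj : jstar i = jstar (κ τ i) := hjeq i (κ τ i) (hQtrans i (κ τ i) τ c₁ hc₁ h1)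
  obtain ⟨τ₁, hg⟩ := hdst i
  obtain ⟨τ₂, hg'⟩ := hdst (κ τ i)
  rw [← hj] at hg'
  have ht1 : rename (fun P : Fin n × Fin n => (P.1, (τ * τ₁) P.2)) (L (jstar i)) = C (d i * c₁) * L (κ τ i) := by
    rw [← rename_col_mul, hg, map_mul, rename_C, h1, ← mul_assoc, ← map_mul]
  have heq := col_translate_scalar_unique L hL0 heigen ht1 hg'
  rw [map_mul, rename_C, h1, ← mul_assoc, ← map_mul, heq]

/-- **Permutation form**: with bijective transports `κ τ`, the rescaled family is exactly permuted by every column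
renaming. [folklore] -/
theorem exists_rescaling_exactly_colPermuted {ι : Type} (L : ι → MvPolynomial (Fin n × Fin n) ℂ)
    (hL0 : ∀ i, L i ≠ 0) (κ : Perm (Fin n) → Perm ι)
    (hassoc : ∀ (τ : Perm (Fin n)) (i : ι), ∃ c : ℂ, c ≠ 0 ∧
      rename (fun P : Fin n × Fin n => (P.1, τ P.2)) (L i) = C c * L (κ τ i))
    (heigen : ∀ (τ : Perm (Fin n)) (i : ι) (c : ℂ),
      rename (fun P : Fin n × Fin n => (P.1, τ P.2)) (L i) = C c * L i → c = 1) :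
    ∃ d : ι → ℂ, (∀ i, d i ≠ 0) ∧ ∀ τ : Perm (Fin n), ∃ κ' : Perm ι, ∀ i,
      rename (fun P : Fin n × Fin n => (P.1, τ P.2)) (C (d i) * L i) = C (d (κ' i)) * L (κ' i) := by
  obtain ⟨d, hd0, h⟩ := exists_rescaling_of_colEigenFree_transport L hL0 (fun τ i => κ τ i) hassoc heigen
  exact ⟨d, hd0, fun τ => ⟨κ τ, fun i => h τ i⟩⟩

end SuperAtoms

end Summit.ValiantsHypothesis.ValiantsHypothesis.Theorems

end
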